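import Literature.Analysis.FluidPDE.AdaptedBackwardKernel
import Literature.Analysis.FluidPDE.ClassicalSolution

/-!
# `AdaptedKernelExists` (stmt-NavierStokesRegularity-2956): explicit adapted kernels of uniform drifts

Support lemmas for the crux `AdaptedFrequency.AdaptedKernelExists`, extracted from the crux work
file `Cruxes/AdaptedKernelExists/Disproof.lean` (cdisprove seat, cycle 1), §3. No conclusion
asserts a route item.

Spatially uniform flows `u(t, x) = a(t) e` with the linear pressure `p = -a'(t) ⟪e, x⟫` are
classical Navier–Stokes solutions for every viscosity (`isClassicalNSSolutionOn_uniform`; the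
parasitic family of Koch–Nadirashvili–Seregin–Šverák 2009, §1 p. 3). Their flow-adapted backward
kernel with pole `(T, x₀)` is EXPLICIT: the backward heat kernel with the MOVING pole
`x₀ - D(t) e`, `D(t) = ∫ₜᵀ a` the displacement still to come. `isAdaptedBackwardKernel_recentred`
proves all five clauses of `Literature.Analysis.FluidPDE.IsAdaptedBackwardKernel` for every `C²`
displacement `D` on `(-∞, T)` with `D' = -a` and `D(T⁻) = 0` (the transport terms cancel exactly;
what is left is the backward heat equation). This is a second non-vacuity witness of the notion,
with an UNBOUNDED drift (the Literature model case is `a ≡ 0`), and the common spine of the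
calibration files `GalileanCalibration` / `SuperTypeIRate` of this directory.

[cite: KochNadirashviliSereginSverak2009, §1 p. 3 (parasitic solutions `u = b(t)`, `p = -b'(t)·x`)]
-/

noncomputable section

namespace Summit.NavierStokesRegularity.NavierStokesRegularity.Theorems.AdaptedKernelExistsNegative.UniformDrift

open Set Filter Topology MeasureTheory Function
open scoped Laplacian InnerProductSpace RealInnerProductSpace ContDiff
open Literature.Analysis.FluidPDE Literature.Analysis

local notation "ℝ³" => EuclideanSpace ℝ (Fin 3)


/-- Spatially uniform velocity `u(t, x) = a(t) e`. -/
def uniformVel (a : ℝ → ℝ) (e : ℝ³) : ℝ → ℝ³ → ℝ³ := fun t _ => a t • e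

/-- The linear pressure `p(t, x) = -b(t) ⟪e, x⟫` driving the uniform flow (`b = a'`). -/
def uniformPres (b : ℝ → ℝ) (e : ℝ³) : ℝ → ℝ³ → ℝ := fun t x => ⟪(-b t) • e, x⟫

/-- Unfolding `uniformVel`. [folklore] -/
@[simp] theorem uniformVel_apply (a : ℝ → ℝ) (e : ℝ³) (t : ℝ) (x : ℝ³) :
    uniformVel a e t x = a t • e := rfl

/-- Unfolding `uniformPres`. [folklore] -/
@[simp] theorem uniformPres_apply (b : ℝ → ℝ) (e : ℝ³) (t : ℝ) (x : ℝ³) :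
    uniformPres b e t x = ⟪(-b t) • e, x⟫ := rfl

/-- The gradient of `y ↦ ⟪v, y⟫` is `v`. -/
theorem hasGradientAt_inner_left (v x : ℝ³) : HasGradientAt (fun y : ℝ³ => ⟪v, y⟫) v x := by
  rw [hasGradientAt_iff_hasFDerivAt]
  have h := (InnerProductSpace.toDual ℝ ℝ³ v).hasFDerivAt (x := x)
  have hfun : (fun y : ℝ³ => ⟪v, y⟫) = ⇑(InnerProductSpace.toDual ℝ ℝ³ v) := by
    funext y
    exact (InnerProductSpace.toDual_apply_apply).symm
  rw [hfun]
  exact h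

/-- The pressure gradient of the uniform flow is `-b(t) e`. [folklore] -/
theorem gradient_uniformPres (b : ℝ → ℝ) (e : ℝ³) (t : ℝ) (x : ℝ³) :
    gradient (uniformPres b e t) x = (-b t) • e :=
  (hasGradientAt_inner_left ((-b t) • e) x).gradient

/-- Constant fields are divergence free. -/
theorem isDivFree_const (c : ℝ³) : VectorCalculus.IsDivFree (fun _ : ℝ³ => c) := fun x => by
  show LinearMap.trace ℝ ℝ³ (fderiv ℝ (fun _ : ℝ³ => c) x : ℝ³ →ₗ[ℝ] ℝ³) = 0
  simp

/-- **Every spatially uniform flow is a classical Navier–Stokes solution** on any time set of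
unique differentiability, for every viscosity, with the linear pressure `p = -a' ⟪e, x⟫`
(copied from `Cruxes/Target/Disproof.lean` §1; KNSS 2009 §1 p. 3). -/
theorem isClassicalNSSolutionOn_uniform {S : Set ℝ} {a : ℝ → ℝ} (hS : UniqueDiffOn ℝ S)
    (ha : ContDiffOn ℝ ∞ a S) (ν : ℝ) (e : ℝ³) :
    IsClassicalNSSolutionOn S ν 0 (uniformVel a e) (uniformPres (derivWithin a S) e) where
  smooth_velocity := by
    have h1 : ContDiffOn ℝ ∞ (fun z : ℝ × ℝ³ => a z.1) (S ×ˢ univ) :=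
      ha.comp contDiffOn_fst fun z hz => (mem_prod.1 hz).1
    show ContDiffOn ℝ ∞ (fun z : ℝ × ℝ³ => a z.1 • e) (S ×ˢ univ)
    exact h1.smul contDiffOn_const
  smooth_pressure := by
    have hb : ContDiffOn ℝ ∞ (derivWithin a S) S := ((contDiffOn_infty_iff_derivWithin hS).1 ha).2
    have h1 : ContDiffOn ℝ ∞ (fun z : ℝ × ℝ³ => (-(derivWithin a S z.1)) • e) (S ×ˢ univ) :=
      ((hb.comp contDiffOn_fst fun z hz => (mem_prod.1 hz).1).neg).smul contDiffOn_const
    show ContDiffOn ℝ ∞ (fun z : ℝ × ℝ³ => ⟪(-(derivWithin a S z.1)) • e, z.2⟫) (S ×ˢ univ)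
    exact h1.inner ℝ contDiffOn_snd
  momentum t ht x := by
    have hdiff : DifferentiableWithinAt ℝ a S t := (ha.differentiableOn (by simp)) t ht
    have h1 : timeDerivWithin S (uniformVel a e) t x = derivWithin a S t • e := by
      rw [timeDerivWithin_apply]
      show derivWithin (fun s => a s • e) S t = derivWithin a S t • e
      exact derivWithin_smul_const hdiff e
    have h2 : convect (uniformVel a e t) (uniformVel a e t) x = 0 := by
      show fderiv ℝ (fun _ : ℝ³ => a t • e) x (a t • e) = 0
      simp
    have h3 : Δ (uniformVel a e t) x = 0 := by
      show Δ (fun _ : ℝ³ => a t • e) x = 0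
      rw [InnerProductSpace.laplacian_const]; rfl
    rw [h1, h2, h3, gradient_uniformPres]
    simp
  divFree t _ := isDivFree_const (a t • e)

/-! ### The recentred heat kernel -/

/-- The backward heat kernel with MOVING pole `x₀ - D(t) e`:
`recentredKernel ν T x₀ e D t x = Γ_{ν(T-t)}(x - x₀ + D(t) e)`, the candidate adapted kernel of
the uniform drift `a(t) e` when `D' = -a` and `D(T⁻) = 0`. -/
def recentredKernel (ν T : ℝ) (x₀ e : ℝ³) (D : ℝ → ℝ) (t : ℝ) (x : ℝ³) : ℝ :=
  backwardHeatKernel ν T (x₀ - D t • e) t x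

/-- Unfolding `recentredKernel` to the Gauss–Weierstrass kernel at `σ = ν(T - t)`, `w = x - x₀ + D(t) e`.
[folklore] -/
theorem recentredKernel_eq (ν T : ℝ) (x₀ e : ℝ³) (D : ℝ → ℝ) (t : ℝ) (x : ℝ³) :
    recentredKernel ν T x₀ e D t x =
      UnboundedOperators.heatKernel (ν * (T - t)) (x - x₀ + D t • e) := by
  simp only [recentredKernel, backwardHeatKernel]
  congr 1
  abel

/-- **Time derivative of the recentred kernel** (chain rule through the jointly smooth heat
kernel; the partial derivatives are the tree's `hasDerivAt_heatKernel_time` and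
`hasFDerivAt_heatKernel`, identified by uniqueness of derivatives): with `σ = ν(T - t)`,
`w = x - x₀ + D(t) e`, `K = G_σ(w)` and `D'(t) = -a(t)`,
`∂ₜ Γ = -ν (‖w‖²/(4σ²) - n/(2σ)) K + (K/(2σ)) a(t) ⟪w, e⟫`. -/
theorem hasDerivAt_recentredKernel {ν : ℝ} (hν : 0 < ν) {T : ℝ} (x₀ e : ℝ³) {D a : ℝ → ℝ}
    {t : ℝ} (ht : t < T) (hD : HasDerivAt D (-a t) t) (x : ℝ³) :
    HasDerivAt (fun s => recentredKernel ν T x₀ e D s x)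
      (-ν * ((‖x - x₀ + D t • e‖ ^ 2 / (4 * (ν * (T - t)) ^ 2) -
          (Module.finrank ℝ ℝ³ : ℝ) / (2 * (ν * (T - t)))) *
          UnboundedOperators.heatKernel (ν * (T - t)) (x - x₀ + D t • e)) +
        UnboundedOperators.heatKernel (ν * (T - t)) (x - x₀ + D t • e) / (2 * (ν * (T - t))) *
          (a t * ⟪x - x₀ + D t • e, e⟫)) t := by
  set σ : ℝ := ν * (T - t) with hσdef
  set w : ℝ³ := x - x₀ + D t • e with hwdef
  have hσ : 0 < σ := mul_pos hν (sub_pos.2 ht)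
  set Φ : ℝ × ℝ³ → ℝ := fun q => UnboundedOperators.heatKernel q.1 q.2 with hΦdef
  have hΦd : DifferentiableAt ℝ Φ (σ, w) := by
    have h := (UnboundedOperators.contDiffOn_uncurry_heatKernel (E := ℝ³) (m := 1)).differentiableOn
      one_ne_zero
    exact h.differentiableAt ((isOpen_Ioi.prod isOpen_univ).mem_nhds ⟨hσ, mem_univ _⟩)
  set L : ℝ × ℝ³ →L[ℝ] ℝ := fderiv ℝ Φ (σ, w) with hLdef
  have hΦ : HasFDerivAt Φ L (σ, w) := hΦd.hasFDerivAt
  -- partial derivative in `σ`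
  have hL1 : L (1, 0) = (‖w‖ ^ 2 / (4 * σ ^ 2) - (Module.finrank ℝ ℝ³ : ℝ) / (2 * σ)) * Φ (σ, w) := by
    have hγ : HasDerivAt (fun r : ℝ => ((r, w) : ℝ × ℝ³)) ((1 : ℝ), (0 : ℝ³)) σ :=
      (hasDerivAt_id σ).prodMk (hasDerivAt_const σ w)
    have h1 : HasDerivAt (Φ ∘ fun r : ℝ => ((r, w) : ℝ × ℝ³)) (L ((1 : ℝ), (0 : ℝ³))) σ :=
      hΦ.comp_hasDerivAt σ hγ
    have h2 : HasDerivAt (Φ ∘ fun r : ℝ => ((r, w) : ℝ × ℝ³))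
        ((‖w‖ ^ 2 / (4 * σ ^ 2) - (Module.finrank ℝ ℝ³ : ℝ) / (2 * σ)) *
          UnboundedOperators.heatKernel σ w) σ :=
      UnboundedOperators.hasDerivAt_heatKernel_time hσ w
    exact h1.unique h2
  -- partial derivative in `w`
  have hL2 : ∀ v : ℝ³, L (0, v) = -(Φ (σ, w) / (2 * σ)) * ⟪w, v⟫ := by
    intro v
    have h1 : HasFDerivAt (fun w' : ℝ³ => Φ (σ, w'))
        (L.comp (ContinuousLinearMap.inr ℝ ℝ ℝ³)) w :=
      hΦ.comp w (hasFDerivAt_prodMk_right σ w)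
    have h2 := h1.unique (UnboundedOperators.hasFDerivAt_heatKernel σ w)
    have h3 := congrArg (fun f : ℝ³ →L[ℝ] ℝ => f v) h2
    simpa [innerSL_apply_apply] using h3
  -- the curve `s ↦ (ν(T - s), x - x₀ + D(s) e)`
  have hψ : HasDerivAt (fun s : ℝ => ((ν * (T - s), x - x₀ + D s • e) : ℝ × ℝ³))
      ((-ν : ℝ), (-a t) • e) t := by
    refine HasDerivAt.prodMk ?_ ?_
    · simpa using ((hasDerivAt_const t T).sub (hasDerivAt_id t)).const_mul ν
    · have := (hD.smul_const e).const_add (x - x₀)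
      simpa using this
  have hcomp := hΦ.comp_hasDerivAt t hψ
  have hfun : (fun s => recentredKernel ν T x₀ e D s x) =
      Φ ∘ fun s : ℝ => ((ν * (T - s), x - x₀ + D s • e) : ℝ × ℝ³) := by
    funext s
    simp only [Function.comp_apply, hΦdef, recentredKernel_eq]
  rw [hfun]
  refine hcomp.congr_deriv ?_
  have hsplit : ((-ν : ℝ), (-a t) • e) = (-ν) • ((1 : ℝ), (0 : ℝ³)) + ((0 : ℝ), (-a t) • e) := by
    ext <;> simp
  rw [hsplit, map_add, map_smul, hL1, hL2, smul_eq_mul, inner_smul_right]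
  ring

/-- **Spatial derivative of the recentred kernel**: `∇Γ(t, ·)(x) = -(K/(2σ)) ⟪w, ·⟫`. -/
theorem hasFDerivAt_recentredKernel (ν T : ℝ) (x₀ e : ℝ³) (D : ℝ → ℝ) (t : ℝ) (x : ℝ³) :
    HasFDerivAt (recentredKernel ν T x₀ e D t)
      ((-(UnboundedOperators.heatKernel (ν * (T - t)) (x - x₀ + D t • e) / (2 * (ν * (T - t))))) •
        innerSL ℝ (x - x₀ + D t • e)) x := by
  have hfun : recentredKernel ν T x₀ e D t =
      (UnboundedOperators.heatKernel (ν * (T - t))) ∘ fun y : ℝ³ => y - x₀ + D t • e := by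
    funext y
    simp only [Function.comp_apply, recentredKernel_eq]
  rw [hfun]
  have hin : HasFDerivAt (fun y : ℝ³ => y - x₀ + D t • e) (ContinuousLinearMap.id ℝ ℝ³) x :=
    ((hasFDerivAt_id x).sub_const x₀).add_const (D t • e)
  have h := (UnboundedOperators.hasFDerivAt_heatKernel (ν * (T - t)) (x - x₀ + D t • e)).comp x hin
  simpa using h

/-- **The recentred heat kernel IS a flow-adapted backward kernel of the uniform drift `a(t) e`**
on `(-∞, T)` with pole `(T, x₀)`, for every `C²` displacement `D` on `(-∞, T)` with `D' = -a`
and `D(t) → 0` as `t ↑ T`: clauses (1) joint `C²` (composition with the jointly smooth heat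
kernel), (2) positivity, (3) the adjoint equation `∂ₜΓ + a(t) e·∇Γ + νΔΓ = 0` (the two transport
terms cancel EXACTLY because the pole moves with the flow, `D' = -a`; what is left is the
backward heat equation of the tree's `laplacian_backwardHeatKernel`), (4) unit mass, (5)
concentration at `x₀` (joint continuity of the caloric extension at `(0⁺, x₀)`, the pole
`x₀ - D(t) e → x₀`). -/
theorem isAdaptedBackwardKernel_recentred {ν : ℝ} (hν : 0 < ν) (T : ℝ) (x₀ e : ℝ³) {D a : ℝ → ℝ}
    (hD2 : ContDiffOn ℝ 2 D (Iio T)) (hD : ∀ t < T, HasDerivAt D (-a t) t)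
    (hD0 : Tendsto D (𝓝[<] T) (𝓝 0)) :
    IsAdaptedBackwardKernel ν (uniformVel a e) (Iio T) T x₀ (recentredKernel ν T x₀ e D) where
  contDiffOn := by
    have hD1 : ContDiffOn ℝ 2 (fun p : ℝ × ℝ³ => D p.1) (Iio T ×ˢ univ) :=
      hD2.comp contDiffOn_fst fun p hp => (mem_prod.1 hp).1
    have h1 : ContDiffOn ℝ 2 (fun p : ℝ × ℝ³ => ν * (T - p.1)) (Iio T ×ˢ univ) :=
      contDiffOn_const.mul (contDiffOn_const.sub contDiffOn_fst)
    have h2 : ContDiffOn ℝ 2 (fun p : ℝ × ℝ³ => p.2 - (x₀ - D p.1 • e)) (Iio T ×ˢ univ) :=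
      contDiffOn_snd.sub (contDiffOn_const.sub (hD1.smul contDiffOn_const))
    have hin := h1.prodMk h2
    have hmaps : MapsTo (fun p : ℝ × ℝ³ => ((ν * (T - p.1), p.2 - (x₀ - D p.1 • e)) : ℝ × ℝ³))
        (Iio T ×ˢ univ) (Ioi (0 : ℝ) ×ˢ univ) := by
      rintro ⟨t, x⟩ ⟨ht, -⟩
      exact ⟨mul_pos hν (sub_pos.2 ht), mem_univ _⟩
    have h := (UnboundedOperators.contDiffOn_uncurry_heatKernel (E := ℝ³) (m := 2)).comp hin hmaps
    exact h
  pos t ht x := UnboundedOperators.heatKernel_pos (mul_pos hν (sub_pos.2 ht)) _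
  adjoint_eq t ht x := by
    have ht' : t < T := ht
    have hσ : 0 < ν * (T - t) := mul_pos hν (sub_pos.2 ht')
    rw [timeDerivWithin_apply, derivWithin_of_mem_nhds (Iio_mem_nhds ht'),
      (hasDerivAt_recentredKernel hν x₀ e ht' (hD t ht') x).deriv,
      (hasFDerivAt_recentredKernel ν T x₀ e D t x).fderiv]
    have hlap : (Δ (recentredKernel ν T x₀ e D t)) x =
        (‖x - x₀ + D t • e‖ ^ 2 / (4 * (ν * (T - t)) ^ 2) -
            (Module.finrank ℝ ℝ³ : ℝ) / (2 * (ν * (T - t)))) *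
          UnboundedOperators.heatKernel (ν * (T - t)) (x - x₀ + D t • e) := by
      have h := laplacian_backwardHeatKernel ν T (x₀ - D t • e) t x
      rw [show x - (x₀ - D t • e) = x - x₀ + D t • e by abel] at h
      exact h
    rw [hlap]
    simp only [uniformVel_apply, smul_apply, innerSL_apply_apply, inner_smul_right, smul_eq_mul]
    ring
  integral_eq_one t ht := integral_backwardHeatKernel hν (x₀ - D t • e) ht
  tendsto_integral_mul φ hφ hM := by
    obtain ⟨M, hM⟩ := hM
    have hM' : ∀ z, ‖φ z‖ ≤ M := fun z => by rw [Real.norm_eq_abs]; exact hM z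
    have h1 := UnboundedOperators.tendsto_heatExtension_nhdsWithin_prod (F := ℝ) hφ hM' x₀
    have h2 : Tendsto (fun t : ℝ => ((ν * (T - t), x₀ - D t • e) : ℝ × ℝ³)) (𝓝[<] T)
        (𝓝[Ioi (0 : ℝ) ×ˢ univ] ((0 : ℝ), x₀)) := by
      refine tendsto_nhdsWithin_iff.2 ⟨?_, ?_⟩
      · have ha : Tendsto (fun t : ℝ => ν * (T - t)) (𝓝[<] T) (𝓝 0) := by
          have hc : Continuous (fun t : ℝ => ν * (T - t)) := by fun_prop
          have := hc.tendsto T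
          simp only [sub_self, mul_zero] at this
          exact this.mono_left nhdsWithin_le_nhds
        have hb : Tendsto (fun t => x₀ - D t • e) (𝓝[<] T) (𝓝 x₀) := by
          have := (hD0.smul_const e).const_sub x₀
          simpa using this
        exact ha.prodMk_nhds hb
      · filter_upwards [self_mem_nhdsWithin] with t ht
        exact ⟨mul_pos hν (sub_pos.2 ht), mem_univ _⟩
    refine Tendsto.congr (fun t => ?_) (h1.comp h2)
    simp only [Function.comp_apply]
    exact (integral_mul_backwardHeatKernel ν T (x₀ - D t • e) t φ).symm

/-- Restriction to a window `[t₀, T)`. -/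
theorem isAdaptedBackwardKernel_recentred_Ico {ν : ℝ} (hν : 0 < ν) (t₀ T : ℝ) (x₀ e : ℝ³)
    {D a : ℝ → ℝ} (hD2 : ContDiffOn ℝ 2 D (Iio T)) (hD : ∀ t < T, HasDerivAt D (-a t) t)
    (hD0 : Tendsto D (𝓝[<] T) (𝓝 0)) :
    IsAdaptedBackwardKernel ν (uniformVel a e) (Ico t₀ T) T x₀ (recentredKernel ν T x₀ e D) :=
  (isAdaptedBackwardKernel_recentred hν T x₀ e hD2 hD hD0).mono Ico_subset_Iio_self
    (uniqueDiffOn_Ico t₀ T)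

/-- **Closed form** of the recentred kernel for `t < T`:
`Γ(t, x) = (4πν)^{-3/2} (T - t)^{-3/2} exp(-‖x - x₀ + D(t) e‖² / (4ν(T - t)))`. -/
theorem recentredKernel_closed_form {ν : ℝ} (hν : 0 ≤ ν) {T : ℝ} (x₀ e : ℝ³) (D : ℝ → ℝ) {t : ℝ}
    (ht : t < T) (x : ℝ³) :
    recentredKernel ν T x₀ e D t x =
      (4 * Real.pi * ν) ^ (-(3 : ℝ) / 2) * (T - t) ^ (-(3 : ℝ) / 2) *
        Real.exp (-(‖x - x₀ + D t • e‖ ^ 2) / (4 * ν * (T - t))) := by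
  rw [recentredKernel, backwardHeatKernel_eq hν _ ht, show x - (x₀ - D t • e) = x - x₀ + D t • e by abel]
  simp


end Summit.NavierStokesRegularity.NavierStokesRegularity.Theorems.AdaptedKernelExistsNegative.UniformDrift

end
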